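import Summits.BirchSwinnertonDyer.Rank1Residual.O5.O5GrowthLaws
import HarnessLib

/-!
# O5 — T12: Tamagawa divisibility of the layer elements at completely split primes (additive `p = 3`)

Add-on to `O5GrowthLaws` (tree, p257909).  ONE conjecture node `TamagawaDivisibilityLawThree` (T12) + two
bookkeeping defs.  T12 is the `μ`-side companion of T11 `CongruenceTransportLawThree`: at a split-multiplicative
prime `ℓ` that splits completely in `ℚ_n` the equivariant Tamagawa/Euler factor is the SCALAR `c_ℓ`, so
`3^{v₃(c_ℓ)}` divides `θ^ε_n`; at other layers the same factor shifts `λ` (T11's `eulerElementThree`).  It is the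
Tamagawa component of the Mazur–Tate 1987 refined conjecture read at the ADDITIVE prime, where the printed
treatments stop (arXiv:2511.07203 Hypothesis (iii): additive `p` must be unramified in `K`; Kurihara: `p ∤ Tam`).
EVIDENCE-labelled conjecture (census cell O5, o5-r1 GEN 2, 2026-08-21): pre-registered C-A2e 125/125 on 5 229
unpaired fresh O5b cells, sharp form ≈ 850 instances with 0 violations on 7 441 cells (`N ∈ (26 000, 500 000)`),
pre-registered held-out on pilot+H2 PARI outputs O5b 10/10, O5a 6/6 (X3, reducible `ρ̄`: 21/24, the 3 failures at
curves with rational 3-torsion = Mazur–Tate's torsion term, absent on O5).  Never a certificate input; no main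
conjecture is used anywhere.  Text of record: `HOME/cells/o5o6/TARGETS.md` §O5 o5-r1 GEN 2 (09:10Z–09:12Z),
`HOME/b2b-bsdres-o5-r1/gen2/LAYER-LAWS.md` §6d, files `HOME/b2b-bsdres-o5-r1/census/c_a2c/t12_*`.
-/

open scoped Classical MatrixGroups ModularForm NumberField
open CongruenceSubgroup Polynomial WeierstrassCurve NumberField Literature.NumberTheory.EllipticCurves
  Literature.NumberTheory.EllipticCurves.ModularForms
  Summit.BirchSwinnertonDyer.Rank1Residual.Additive

namespace Summit.BirchSwinnertonDyer.Rank1Residual.O5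

/-! ## §3b T12 — Tamagawa divisibility at completely split primes (the `μ`-side companion of T11) -/

open Classical in
/-- The primes `ℓ ‖ N`, `ℓ ≠ 3`, that are COMPLETELY SPLIT in the layer field `ℚ_n`
(`ℓ ≡ ±1 (mod 3^{n+1})`) and at which the branch curve `E^ε` (`E` for `ε = +`, the twist `E^{(−3)}`
for `ε = −`) has SPLIT multiplicative reduction (`χ_ε(ℓ) · a_ℓ(E) = +1`). [folklore] -/
noncomputable def splitPrimesThree (W : WeierstrassCurve ℚ) [W.IsElliptic] (ε : Bool) (n : ℕ) : Finset ℕ :=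
  (W.conductorNorm ℤ).primeFactors.filter fun ℓ =>
    ℓ ≠ 3 ∧ ¬ (ℓ ^ 2 ∣ W.conductorNorm ℤ) ∧
    ((ℓ : ZMod (3 ^ (n + 1))) = 1 ∨ (ℓ : ZMod (3 ^ (n + 1))) = -1) ∧
    (if ε then (1 : ℚ) else (jacobiSym (-3) ℓ : ℚ)) * (W.LFunction ℓ : ℚ) = 1

/-- `s^ε_n(W) = Σ_{ℓ ∈ splitPrimesThree W ε n} v₃(c_ℓ(E^ε))`, where for a split multiplicative prime the
Tamagawa number is `c_ℓ = v_ℓ(Δ_min)` (Tate; the twist by `χ₋₃` is unramified at `ℓ ≠ 3`, so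
`v_ℓ(Δ_min(E^{(−3)})) = v_ℓ(Δ_min(E))`).  `W` is assumed globally minimal. [folklore] -/
noncomputable def tamagawaSplitExponentThree (W : WeierstrassCurve ℚ) [W.IsElliptic] (ε : Bool) (n : ℕ) : ℕ :=
  ∑ ℓ ∈ splitPrimesThree W ε n, padicValNat 3 (padicValRat ℓ W.Δ).toNat

/-- **T12 TAMAGAWA DIVISIBILITY LAW (CONJECTURE; EVIDENCE-labelled; the `μ`-side of the equivariant
Tamagawa factor whose `λ`-side is T11).**  For an O5b curve `W` at `3` with newform `f`, every layer
`n ≥ 1` and both branches `ε`:  `3^{s^ε_n(W)}` divides `θ^ε_n(f)` coefficientwise, i.e.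
`μ(θ^ε_n) ≥ s^ε_n(W) = Σ v₃(c_ℓ)` summed over the split-multiplicative primes of `E^ε` that split
completely in `ℚ_n` (`polyMuThree 0 = ⊤`, so a vanishing layer satisfies it trivially).
READING.  This is the Tamagawa component of the Mazur–Tate refined ("BSD-type") conjecture [MT87] —
for a prime `ℓ` completely split in `K = ℚ_n` the equivariant Tamagawa module is induced from the trivial
group, its Fitting ideal is the SCALAR `c_ℓ`, so `θ_K ∈ c_ℓ · (…)` — read at the ADDITIVE prime `3`, where
the 2025 ETNC treatment (arXiv:2511.07203, Hypothesis (iii): "if `E` has additive reduction at `p` then `p`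
is unramified in `K`"; Thm 1.7 with `S′` = the split-multiplicative primes completely split in `K`; Cor 1.9
needs `p ≥ 11`, `E` semistable) does not apply (`3` is totally ramified in `ℚ_n`) and Kurihara's annihilation
results assume `p ∤ Tam(E)` (loc. cit. §1) — i.e. exclude exactly the curves this law is about.  At primes
NOT completely split the same factor is not scalar and migrates into `λ` (the `3^{v}`-shifts of T11 /
`eulerElementThree`).  Second mechanism for `ℓ ≡ −1 (mod 3^{n+1})`: `3 ∣ c_ℓ` iff `ρ̄_{W,3}` is unramified at
`ℓ`, so (Ribet) a level-lowered newform `g ≡ f (mod 𝔭)` exists, good at `ℓ` with `a_ℓ(g) ≡ ±(ℓ+1) ≡ 0`, whose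
constant Euler factor `(ℓ + 1 − a_ℓ(g))/ℓ ≡ 0 (mod 𝔭)` while `W`'s own factor `1 − χa_ℓ/ℓ` is a unit; the
EPW congruence of `Σ`-depleted layer elements then forces `θ^ε_n(f) ≡ 0 (mod 3)`.
NORMALISATION.  `θ⁺_n = mazurTateElement f 3 n` is normalised by `ratPlusSymbol` (the newform lattice,
`[0]⁺ = L(f,1)/Ω⁺_f`); the evidence was computed in PARI's `msfromell` / cc-eng-3's ENG-D normalisation (the
Néron lattice of `W`), which differs by a `3`-adic unit whenever the Manin constant is prime to `3` (O5b classes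
carry no `3`-isogeny since `ρ̄` is irreducible) — `= 1` for every optimal curve in the evidence range.
EVIDENCE (E1 discipline).  DISCOVERED on the 2 284 C-A2c congruent pairs (every convention-distinguishing
pair-layer was unclean: 1 398/1 398); PRE-REGISTERED intrinsic test C-A2e (`ℓ ≡ −1` part, kill rule on the
5 229 fresh O5b cells NOT in any pair): 125/125 instances `μ ≥ 1` or `θ = 0` (all cells: 344/344; base rate of
`μ ≥ 1 ∨ θ = 0` at `n = 2` is 18 %); POST-HOC sharpening to the full statement (both signs `ℓ ≡ ±1`, exponent
`s`): every one of the ≈ 850 (cell, branch, layer) instances with `s ≥ 1` on the 7 441 fresh cells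
(`N ∈ (26 000, 500 000)`, layers `n ≤ 4/5`) has `μ ≥ s` (14 with `s = 2`), 0 violations; the relative form
`μ(θ_n) − μ(θ_top) ≥ s` has exactly one exception (344745g1, `ℓ = 163 ≡ 1 mod 81`, whose top layer `n = 4`
itself has `μ = 1` and `λ = 28 = 27 + 1` — the migrated factor).  Files: `HOME/…/census/c_a2c/t12_*`.
FALSIFIER: one O5b curve, layer and branch with `θ^ε_n ≠ 0` and `μ(θ^ε_n) < s^ε_n(W)` (in the Néron
normalisation).  [conjecture: O5-T12-TamagawaDivisibility, EVIDENCE: census C-A2e 2026-08-21 + MT87] -/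
@[conjecture] def TamagawaDivisibilityLawThree : Prop :=
  ∀ (W : WeierstrassCurve ℚ) [W.IsElliptic] [W.IsGloballyMinimal] [NeZero (W.conductorNorm ℤ)]
    (f : CuspForm (Gamma0 (W.conductorNorm ℤ)) 2),
    IsNewformOf W f → ClassO5 W 3 → SubTprime W 3 →
    ∀ (n : ℕ) (ε : Bool), 1 ≤ n →
      ((tamagawaSplitExponentThree W ε n : ℤ) : WithTop ℤ) ≤ polyMuThree (branchElementThree f ε n)


end Summit.BirchSwinnertonDyer.Rank1Residual.O5
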